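import Summits.CriticalPhenomena.Ising3D.Control2DTruncation
import Summits.CriticalPhenomena.Ising3D.Control2DMidScheme
import Mathlib.Analysis.Convex.Slope
import Mathlib.Tactic.Linarith
import Mathlib.Tactic.Positivity
import Mathlib.Tactic.Ring
import HarnessLib

/-!
# The 2D control: the log-free cell scheme for obligation (C) — proved
(cell `pub-ising3x`, seat controls-1; mathematics of the kernel checker `Control2DCellCheck.lean`)

HONEST FRAMING: lottery ticket; floor = tightest certified 3D Ising CFT bounds; no exact-solution
claim without a proof.

By `Control2DTruncation.lean`, obligation (C) at `(Δ, ℓ)` follows from `φ[F_-[Q_N]] ≥ 0`, and for a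
point functional at `Δ_σ = 1/8` this is `Ψ(Δ) = Σ_d σ_d c_d f_d(Δ) b_d(Δ) ≥ 0` over the `2K`
evaluation data, with `f_d(Δ) = (x_d y_d)^{Δ/2}` (CONVEX and non-increasing in `Δ`) and
`b_d(Δ) = brR N ℓ Δ x_d y_d` (non-negative and NON-DECREASING on `Δ ≥ ℓ`, `Control2DChiralMono`).
On a cell `[t₀, t₁]` with a further stencil point `t₂ > t₁`, freezing `b_d` at `t₀` in the positive
terms and at `t₁` in the negative ones gives `Ψ ≥ F - G` with `F(Δ) = Σ_{σ=+} c_d b_d(t₀) f_d(Δ)` and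
`G(Δ) = Σ_{σ=-} c_d b_d(t₁) f_d(Δ)` both CONVEX, and then the three-slope / chord test of the (M)
scheme (`cell_nonneg_of_convex₂`, here with an arbitrary right stencil `t₂`):
`G(t₁) ≤ F(t₁)` and `G(t₀) ≤ F(t₁) + (t₁-t₀)(F(t₁)-F(t₂))/(t₂-t₁)` imply `Ψ ≥ 0` on the cell —
again inequalities between VALUES only (no logarithms, no derivatives), which the kernel checker
decides in interval arithmetic. This file: `PsiC`, its identification with `φ[F_-[Q_N]]`
(`pointFunctional_QN_eq_PsiC`), the frozen sums `FC`/`GC`, the comparison `PsiC ≥ FC - GC`, the cell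
lemma, and the cover of `[T₀, T_K]` by a cut list.
-/

namespace Summit.CriticalPhenomena.Ising3D.Control2D

open Set Finset
open Literature.MathematicalPhysics.QuantumFieldTheory.ConformalBootstrap3D

/-! ### The signed sum `Ψ` and its frozen minorant -/

/-- `f_d(Δ) = (xy)^{Δ/2}`. [folklore] -/
noncomputable def fC (x y Δ : ℝ) : ℝ := (x * y) ^ (Δ / 2)

/-- `Ψ(Δ) = Σ_d σ_d c_d f_d(Δ) brR N ℓ Δ x_d y_d` — the value of `φ[F_-[Q_N]]` at a point functional.
[folklore] -/
noncomputable def PsiC (rds : List RDat) (N ℓ : ℕ) (Δ : ℝ) : ℝ :=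
  (rds.map fun d => (if d.σ then (1 : ℝ) else -1) * (d.c * (fC d.x d.y Δ * brR N ℓ Δ d.x d.y))).sum

/-- The positive terms with `b` frozen at `t₀`: `F(Δ) = Σ_{σ=+} c_d brR(t₀) f_d(Δ)`. [folklore] -/
noncomputable def FC (rds : List RDat) (N ℓ : ℕ) (t₀ Δ : ℝ) : ℝ :=
  (rds.map fun d => if d.σ then d.c * brR N ℓ t₀ d.x d.y * fC d.x d.y Δ else 0).sum

/-- The negative terms with `b` frozen at `t₁`: `G(Δ) = Σ_{σ=-} c_d brR(t₁) f_d(Δ)`. [folklore] -/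
noncomputable def GC (rds : List RDat) (N ℓ : ℕ) (t₁ Δ : ℝ) : ℝ :=
  (rds.map fun d => if d.σ then 0 else d.c * brR N ℓ t₁ d.x d.y * fC d.x d.y Δ).sum

/-- `f_d = fM (1/2) x y 0`, so it is convex in `Δ`. [folklore] -/
theorem fC_eq_fM (x y Δ : ℝ) : fC x y Δ = fM (1 / 2) x y 0 Δ := by
  simp [fC, fM]; ring

/-- `f_d` is convex on `ℝ` (`x, y > 0`). [folklore] -/
theorem convexOn_fC {x y : ℝ} (hx : 0 < x) (hy : 0 < y) : ConvexOn ℝ univ (fC x y) := by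
  have h := convexOn_fM (by norm_num : (0 : ℝ) ≤ 1 / 2) hx hy 0
  have e : fC x y = fM (1 / 2) x y 0 := funext fun Δ => fC_eq_fM x y Δ
  rw [e]; exact h

/-- `f_d ≥ 0`. [folklore] -/
theorem fC_nonneg {x y : ℝ} (hx : 0 < x) (hy : 0 < y) (Δ : ℝ) : 0 ≤ fC x y Δ := by
  unfold fC; positivity

/-- `f_d` is non-increasing (`0 < xy ≤ 1`). [folklore] -/
theorem fC_antitone {x y : ℝ} (hx : 0 < x) (hx1 : x < 1) (hy : 0 < y) (hy1 : y < 1) {Δ₁ Δ₂ : ℝ}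
    (h : Δ₁ ≤ Δ₂) : fC x y Δ₂ ≤ fC x y Δ₁ := by
  unfold fC
  exact Real.rpow_le_rpow_of_exponent_ge (mul_pos hx hy) (by nlinarith) (by linarith)

/-- A non-negative multiple of a convex function plus a convex function is convex (the induction step
for `FC`/`GC`). [folklore] -/
theorem convexOn_const_mul_add {f g : ℝ → ℝ} {a : ℝ} (ha : 0 ≤ a) (hf : ConvexOn ℝ univ f)
    (hg : ConvexOn ℝ univ g) : ConvexOn ℝ univ (fun x => a * f x + g x) := by
  have := (hf.smul ha).add hg
  refine ⟨convex_univ, fun x _ y _ p q hp hq hpq => ?_⟩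
  have h := this.2 (mem_univ x) (mem_univ y) hp hq hpq
  simp only [smul_eq_mul, Pi.add_apply] at h ⊢
  exact h

/-- `F` is convex in `Δ` (admissible data, `t₀ ≥ ℓ`). [folklore] -/
theorem convexOn_FC {rds : List RDat} (h : ∀ d ∈ rds, d.ok) (N ℓ : ℕ) {t₀ : ℝ} (ht : (ℓ : ℝ) ≤ t₀) :
    ConvexOn ℝ univ (FC rds N ℓ t₀) := by
  induction rds with
  | nil => exact ⟨convex_univ, fun _ _ _ _ _ _ _ _ _ => by simp [FC]⟩
  | cons d tl ih =>
    have htl : ∀ d' ∈ tl, d'.ok := fun d' hd' => h d' (List.mem_cons_of_mem _ hd')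
    have hd := h d List.mem_cons_self
    have hc : 0 ≤ (if d.σ then d.c * brR N ℓ t₀ d.x d.y else 0) := by
      cases d.σ
      · simp
      · simpa using mul_nonneg hd.1 (brR_nonneg N ℓ ht hd.2.1 hd.2.2.2.1)
    have key := convexOn_const_mul_add hc (convexOn_fC hd.2.1 hd.2.2.2.1) (ih htl)
    have e : FC (d :: tl) N ℓ t₀ = fun Δ => (if d.σ then d.c * brR N ℓ t₀ d.x d.y else 0) * fC d.x d.y Δ +
        FC tl N ℓ t₀ Δ := by
      funext Δ; simp only [FC, List.map_cons, List.sum_cons]; cases d.σ <;> simp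
    rw [e]; exact key

/-- `G` is convex in `Δ` (admissible data, `t₁ ≥ ℓ`). [folklore] -/
theorem convexOn_GC {rds : List RDat} (h : ∀ d ∈ rds, d.ok) (N ℓ : ℕ) {t₁ : ℝ} (ht : (ℓ : ℝ) ≤ t₁) :
    ConvexOn ℝ univ (GC rds N ℓ t₁) := by
  induction rds with
  | nil => exact ⟨convex_univ, fun _ _ _ _ _ _ _ _ _ => by simp [GC]⟩
  | cons d tl ih =>
    have htl : ∀ d' ∈ tl, d'.ok := fun d' hd' => h d' (List.mem_cons_of_mem _ hd')
    have hd := h d List.mem_cons_self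
    have hc : 0 ≤ (if d.σ then 0 else d.c * brR N ℓ t₁ d.x d.y) := by
      cases d.σ
      · simpa using mul_nonneg hd.1 (brR_nonneg N ℓ ht hd.2.1 hd.2.2.2.1)
      · simp
    have key := convexOn_const_mul_add hc (convexOn_fC hd.2.1 hd.2.2.2.1) (ih htl)
    have e : GC (d :: tl) N ℓ t₁ = fun Δ => (if d.σ then 0 else d.c * brR N ℓ t₁ d.x d.y) * fC d.x d.y Δ +
        GC tl N ℓ t₁ Δ := by
      funext Δ; simp only [GC, List.map_cons, List.sum_cons]; cases d.σ <;> simp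
    rw [e]; exact key

/-- **Freezing the monotone factor**: on `Δ ∈ [t₀, t₁]`, `t₀ ≥ ℓ`: `Ψ(Δ) ≥ F(Δ) - G(Δ)`
(positive terms: `b_d(Δ) ≥ b_d(t₀)`; negative terms: `b_d(Δ) ≤ b_d(t₁)`; everything else `≥ 0`).
[folklore] -/
theorem PsiC_ge_FC_sub_GC {rds : List RDat} (h : ∀ d ∈ rds, d.ok) (N ℓ : ℕ) {t₀ t₁ Δ : ℝ}
    (ht₀ : (ℓ : ℝ) ≤ t₀) (h0 : t₀ ≤ Δ) (h1 : Δ ≤ t₁) :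
    FC rds N ℓ t₀ Δ - GC rds N ℓ t₁ Δ ≤ PsiC rds N ℓ Δ := by
  induction rds with
  | nil => simp [FC, GC, PsiC]
  | cons d tl ih =>
    have htl : ∀ d' ∈ tl, d'.ok := fun d' hd' => h d' (List.mem_cons_of_mem _ hd')
    have hd := h d List.mem_cons_self
    have ih' := ih htl
    obtain ⟨hc, hx, hx1, hy, hy1⟩ := hd
    have hf : 0 ≤ fC d.x d.y Δ := fC_nonneg hx hy Δ
    have hbm0 : brR N ℓ t₀ d.x d.y ≤ brR N ℓ Δ d.x d.y := brR_mono N ℓ ht₀ h0 hx hy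
    have hbm1 : brR N ℓ Δ d.x d.y ≤ brR N ℓ t₁ d.x d.y := brR_mono N ℓ (ht₀.trans h0) h1 hx hy
    simp only [FC, GC, PsiC, List.map_cons, List.sum_cons] at ih' ⊢
    cases d.σ
    · simp only [Bool.false_eq_true, ↓reduceIte, zero_add]
      have : d.c * (fC d.x d.y Δ * brR N ℓ Δ d.x d.y) ≤ d.c * brR N ℓ t₁ d.x d.y * fC d.x d.y Δ := by
        have := mul_le_mul_of_nonneg_left hbm1 (mul_nonneg hc hf)
        nlinarith
      linarith
    · simp only [↓reduceIte, one_mul]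
      have : d.c * brR N ℓ t₀ d.x d.y * fC d.x d.y Δ ≤ d.c * (fC d.x d.y Δ * brR N ℓ Δ d.x d.y) := by
        have := mul_le_mul_of_nonneg_left hbm0 (mul_nonneg hc hf)
        nlinarith
      linarith

/-! ### The cell test with an arbitrary right stencil -/

/-- **The log-free cell test, general stencil.** `F, G` convex on `ℝ`, points `t₀ < t₁ < t₂`: if
`G(t₁) ≤ F(t₁)` and `G(t₀) ≤ F(t₁) + (t₁ - t₀)(F(t₁) - F(t₂))/(t₂ - t₁)` then `G ≤ F` on `[t₀, t₁]`.
PROVED (three-slope inequality for `F` at `Δ ≤ t₁ < t₂`, chord for `G`). [folklore] -/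
theorem cell_nonneg_of_convex₂ {F G : ℝ → ℝ} (hF : ConvexOn ℝ univ F) (hG : ConvexOn ℝ univ G)
    {t₀ t₁ t₂ : ℝ} (h01 : t₀ < t₁) (h12 : t₁ < t₂) (hend : G t₁ ≤ F t₁)
    (hstart : G t₀ ≤ F t₁ + (t₁ - t₀) * (F t₁ - F t₂) / (t₂ - t₁)) {Δ : ℝ} (hΔ : Δ ∈ Icc t₀ t₁) :
    G Δ ≤ F Δ := by
  obtain ⟨hlo, hhi⟩ := hΔ
  have H3 : 0 < t₂ - t₁ := by linarith
  -- chord bound for G on [t₀, t₁]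
  have hG' : (t₁ - t₀) * G Δ ≤ (t₁ - Δ) * G t₀ + (Δ - t₀) * G t₁ := by
    rcases eq_or_lt_of_le hlo with h | hlt
    · subst h; nlinarith
    rcases eq_or_lt_of_le hhi with h' | hlt'
    · rw [h']; nlinarith
    have := hG.secant_mono_aux1 (mem_univ t₀) (mem_univ t₁) hlt hlt'
    linarith
  -- three-slope bound for F at Δ ≤ t₁ < t₂: (t₂-t₁) F(Δ) ≥ (t₂-t₁) F(t₁) + (t₁-Δ)(F(t₁)-F(t₂))
  have hF' : (t₂ - t₁) * F t₁ + (t₁ - Δ) * (F t₁ - F t₂) ≤ (t₂ - t₁) * F Δ := by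
    rcases eq_or_lt_of_le hhi with h' | hlt'
    · rw [h']; nlinarith
    have := hF.secant_mono_aux1 (mem_univ Δ) (mem_univ t₂) hlt' h12
    nlinarith
  -- the start condition, cleared of the division
  have hstart' : (t₂ - t₁) * G t₀ ≤ (t₂ - t₁) * F t₁ + (t₁ - t₀) * (F t₁ - F t₂) := by
    have := mul_le_mul_of_nonneg_left hstart H3.le
    rw [mul_add, mul_div_assoc', mul_div_cancel_left₀ _ H3.ne'] at this
    linarith
  -- combine: weights (t₁-Δ) ≥ 0 and (Δ-t₀) ≥ 0
  have w0 : 0 ≤ t₁ - Δ := by linarith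
  have w1 : 0 ≤ Δ - t₀ := by linarith
  have H1 : 0 < t₁ - t₀ := by linarith
  have e1 := mul_le_mul_of_nonneg_left hG' H3.le
  have e2 := mul_le_mul_of_nonneg_left hstart' w0
  have e3 := mul_le_mul_of_nonneg_left hend (mul_nonneg w1 H3.le)
  have e4 := mul_le_mul_of_nonneg_left hF' H1.le
  have key : (t₁ - t₀) * (t₂ - t₁) * (G Δ - F Δ) ≤ 0 := by linarith
  have hpos : 0 < (t₁ - t₀) * (t₂ - t₁) := mul_pos H1 H3
  by_contra hcon
  have : 0 < (t₁ - t₀) * (t₂ - t₁) * (G Δ - F Δ) := mul_pos hpos (by linarith)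
  linarith

/-- **`Ψ ≥ 0` on a cell** from the two value inequalities (data admissible, `ℓ ≤ t₀ < t₁ < t₂`).
[folklore] -/
theorem PsiC_nonneg_on_cell {rds : List RDat} (h : ∀ d ∈ rds, d.ok) (N ℓ : ℕ) {t₀ t₁ t₂ : ℝ}
    (ht₀ : (ℓ : ℝ) ≤ t₀) (h01 : t₀ < t₁) (h12 : t₁ < t₂)
    (hend : GC rds N ℓ t₁ t₁ ≤ FC rds N ℓ t₀ t₁)
    (hstart : GC rds N ℓ t₁ t₀ ≤ FC rds N ℓ t₀ t₁ +
      (t₁ - t₀) * (FC rds N ℓ t₀ t₁ - FC rds N ℓ t₀ t₂) / (t₂ - t₁)) :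
    ∀ Δ ∈ Icc t₀ t₁, 0 ≤ PsiC rds N ℓ Δ := by
  intro Δ hΔ
  have h1 := cell_nonneg_of_convex₂ (convexOn_FC h N ℓ ht₀) (convexOn_GC h N ℓ (ht₀.trans h01.le))
    h01 h12 hend hstart hΔ
  have h2 := PsiC_ge_FC_sub_GC h N ℓ ht₀ hΔ.1 hΔ.2
  linarith

/-! ### `Ψ` is `φ[F_-[Q_N]]` -/

/-- **`φ[F_-[Q_N]] = Ψ`** for the point functional with rational nodes/weights at `Δ_σ = 1/8` and even
`ℓ` (nodes in the open square). [folklore] -/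
theorem pointFunctional_QN_eq_PsiC {n : ℕ} (w z zb : Fin n → ℚ) (hz : ∀ k, 0 < z k ∧ z k < 1)
    (hzb : ∀ k, 0 < zb k ∧ zb k < 1) {N ℓ : ℕ} (hℓ : Even ℓ) (Δ : ℝ) :
    pointFunctional (fun k => ((w k : ℚ) : ℝ)) (fun k => ((z k : ℚ) : ℝ)) (fun k => ((zb k : ℚ) : ℝ))
        (crossF (1 / 8) (-1) (QN N ℓ Δ)) =
      PsiC (realData w z zb) N ℓ Δ := by
  have hz' : ∀ k, ((z k : ℚ) : ℝ) ∈ Ioo (0 : ℝ) 1 := fun k =>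
    ⟨by exact_mod_cast (hz k).1, by exact_mod_cast (hz k).2⟩
  have hzb' : ∀ k, ((zb k : ℚ) : ℝ) ∈ Ioo (0 : ℝ) 1 := fun k =>
    ⟨by exact_mod_cast (hzb k).1, by exact_mod_cast (hzb k).2⟩
  rw [pointFunctional_crossF_QN _ _ _ hz' hzb' (1 / 8) hℓ Δ, PsiC, realData, List.map_append,
    List.sum_append, List.map_ofFn, List.map_ofFn, List.sum_ofFn, List.sum_ofFn, ← Finset.sum_add_distrib]
  refine Finset.sum_congr rfl fun k _ => ?_
  simp only [Function.comp_apply, fC]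
  have e18 : ((1 : ℝ) / 8) = (1 / 8 : ℝ) := rfl
  have := node_split (w k) ((((1 - ((z k : ℚ) : ℝ)) * (1 - ((zb k : ℚ) : ℝ))) ^ ((1 : ℝ) / 8)))
    (((((z k : ℚ) : ℝ) * ((zb k : ℚ) : ℝ)) ^ ((1 : ℝ) / 8)))
    ((((z k : ℚ) : ℝ) * ((zb k : ℚ) : ℝ)) ^ (Δ / 2) * brR N ℓ Δ ((z k : ℚ) : ℝ) ((zb k : ℚ) : ℝ))
    (((1 - ((z k : ℚ) : ℝ)) * (1 - ((zb k : ℚ) : ℝ))) ^ (Δ / 2) *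
      brR N ℓ Δ (1 - ((z k : ℚ) : ℝ)) (1 - ((zb k : ℚ) : ℝ)))
  rw [e18] at this
  linear_combination this

/-! ### Cover of `[T₀, T_K]` by the cells of a cut list -/

/-- If `Ψ ≥ 0` on every cell `[T k, T (k+1)]`, `k < K` (`K ≥ 1`), then `Ψ ≥ 0` on `[T 0, T K]`.
[folklore] -/
theorem nonneg_of_cells {Ψ : ℝ → ℝ} (T : ℕ → ℝ) {K : ℕ} (hK : 1 ≤ K)
    (hcell : ∀ k < K, ∀ Δ ∈ Icc (T k) (T (k + 1)), 0 ≤ Ψ Δ) :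
    ∀ Δ ∈ Icc (T 0) (T K), 0 ≤ Ψ Δ := by
  intro Δ hΔ
  obtain ⟨k, hk, hk1, hk2⟩ := exists_step_of_mem_Icc T hK hΔ.1 hΔ.2
  exact hcell k hk Δ ⟨hk1, hk2⟩

end Summit.CriticalPhenomena.Ising3D.Control2D
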